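import Summits.CriticalPhenomena.PercolationContinuityZ3.Theorems.PercNearOneGluingNoHeavyLowerTailAntipodalR1CutVertexGrades
import Summits.CriticalPhenomena.PercolationContinuityZ3.Theorems.PercNearOneGluingNoHeavyLowerTailAntipodalR1OneSumApexCut
import Summits.CriticalPhenomena.PercolationContinuityZ3.Theorems.PercNearOneGluingNoHeavyLowerTailAntipodalR1TwoCut
import HarnessLib

/-!
# ANTI₁ across a cut vertex, graded: the apex as a cut vertex

Support file for `stmt-CriticalPhenomena-4575` (memo `prim-gen-kcluster/KCLUSTER-gen73.md` §1.6 / §1.8 (D),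
graded; conjecture ANTI₁-GRADED of `KCLUSTER-gen52.md` §3).  No definitions, no named facts, no sorries.
Vocabulary of `AntipodalR1` (gen 62); `…OneSumApexCut` (the ungraded case), `…CutVertexGrades` (grade
shift of a 1-sum) of gen 78.

**Theorem** (`card_lSet_grade_eq_card_rSet_of_apexCut`).  If the apex `a` is a cut vertex separating
the terminals (`G = P ∪_a Q`, `b` on the `P` side, `c` interior to `Q`), then for every level `t`:
`#{x ∈ L : g(x) = t} = #{x ∈ R(b,c) : g(x) = t}` — ANTI₁-GRADED with equality.  The fibrewise bijection
`ω_P ⊕ ω_Q ∈ L ↔ ω_P ⊕ ω̄_Q ∈ R` of the ungraded file preserves the grade, because the grade of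
`ω_P ⊕ ω_Q` is `g_P(ω_P) + c^Q(ω_Q) − 2·#I_Q` with `c^Q` swap-invariant (`grade_flipQ_eq`).  [this work]
-/

namespace Summit.CriticalPhenomena.PercolationContinuityZ3.Theorems

namespace AntipodalR1

open Finset Relation SimpleGraph

variable {V ιP ιQ : Type*}

section ApexCut

variable {endsP : ιP → Sym2 V} {endsQ : ιQ → Sym2 V} {a b c : V}
variable [Fintype V]

/-- Swapping the colours of the far block does not change the grade. [this work] -/
theorem grade_flipQ_eq (hsep : ∀ w i, w ∈ endsP i → ∀ j, w ∈ endsQ j → w = a)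
    (ωP : ιP → Bool) (ωQ : ιQ → Bool) :
    (Nat.card (fromEdgeSet {s : Sym2 V | ∃ e, Sum.elim ωP ωQ e = true ∧
          Sum.elim endsP endsQ e = s}).ConnectedComponent +
        Nat.card (fromEdgeSet {s : Sym2 V | ∃ e, Sum.elim ωP ωQ e = false ∧
          Sum.elim endsP endsQ e = s}).ConnectedComponent) =
      (Nat.card (fromEdgeSet {s : Sym2 V | ∃ e, Sum.elim ωP (fun j => !ωQ j) e = true ∧
          Sum.elim endsP endsQ e = s}).ConnectedComponent +
        Nat.card (fromEdgeSet {s : Sym2 V | ∃ e, Sum.elim ωP (fun j => !ωQ j) e = false ∧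
          Sum.elim endsP endsQ e = s}).ConnectedComponent) := by
  have h1 := grade_cutVertex_eq hsep ωP ωQ
  have h2 := grade_cutVertex_eq hsep ωP (fun j => !ωQ j)
  have h3 := card_ccInsideT_flip_add (V := V) (u := a) (endsT := endsQ) ωQ
  omega

variable [Fintype ιP] [DecidableEq ιP] [Fintype ιQ] [DecidableEq ιQ]

open Classical in
/-- The graded `L`-fibre over `ω_Q` is the graded `R`-fibre over `ω̄_Q`. [this work] -/
theorem filter_lSet_grade_eq_rSet_flip_of_apexCut
    (hsep : ∀ w i, w ∈ endsP i → ∀ j, w ∈ endsQ j → w = a) (hb : ∀ j, b ∈ endsQ j → b = a)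
    (hcQ : ∃ j, c ∈ endsQ j) (hca : c ≠ a) (ωQ : ιQ → Bool) (t : ℕ) :
    (univ.filter fun ωP : ιP → Bool => Sum.elim ωP ωQ ∈ lSet (Sum.elim endsP endsQ) a b c ∧
        (Nat.card (fromEdgeSet {s : Sym2 V | ∃ e, Sum.elim ωP ωQ e = true ∧
          Sum.elim endsP endsQ e = s}).ConnectedComponent +
        Nat.card (fromEdgeSet {s : Sym2 V | ∃ e, Sum.elim ωP ωQ e = false ∧
          Sum.elim endsP endsQ e = s}).ConnectedComponent) = t) =
      (univ.filter fun ωP : ιP → Bool =>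
        Sum.elim ωP (fun j => !ωQ j) ∈ rSet (Sum.elim endsP endsQ) a b c ∧
        (Nat.card (fromEdgeSet {s : Sym2 V | ∃ e, Sum.elim ωP (fun j => !ωQ j) e = true ∧
          Sum.elim endsP endsQ e = s}).ConnectedComponent +
        Nat.card (fromEdgeSet {s : Sym2 V | ∃ e, Sum.elim ωP (fun j => !ωQ j) e = false ∧
          Sum.elim endsP endsQ e = s}).ConnectedComponent) = t) := by
  refine filter_congr fun ωP _ => ?_
  rw [mem_lSet_iff_mem_rSet_flip_of_apexCut hsep hb hcQ hca ωP ωQ, grade_flipQ_eq hsep ωP ωQ]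

open Classical in
/-- **ANTI₁-GRADED with equality when the apex separates the terminals** (memo `KCLUSTER-gen73` §1.6,
§1.8 (D), graded kernel form).  `G = P ∪ Q` glued at the apex `a` alone, `b` met by edges of `Q` only if
`b = a`, `c` interior to `Q`.  Then `#{x ∈ L : g(x) = t} = #{x ∈ R(b,c) : g(x) = t}` for every `t`.
[this work] -/
theorem card_lSet_grade_eq_card_rSet_of_apexCut (endsP : ιP → Sym2 V) (endsQ : ιQ → Sym2 V)
    (a b c : V)
    (hsep : ∀ w i, w ∈ endsP i → ∀ j, w ∈ endsQ j → w = a) (hb : ∀ j, b ∈ endsQ j → b = a)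
    (hcQ : ∃ j, c ∈ endsQ j) (hca : c ≠ a) (t : ℕ) :
    (univ.filter fun x : ιP ⊕ ιQ → Bool => x ∈ lSet (Sum.elim endsP endsQ) a b c ∧
        (Nat.card (fromEdgeSet {s : Sym2 V | ∃ e, x e = true ∧
          Sum.elim endsP endsQ e = s}).ConnectedComponent +
        Nat.card (fromEdgeSet {s : Sym2 V | ∃ e, x e = false ∧
          Sum.elim endsP endsQ e = s}).ConnectedComponent) = t).card =
      (univ.filter fun x : ιP ⊕ ιQ → Bool => x ∈ rSet (Sum.elim endsP endsQ) a b c ∧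
        (Nat.card (fromEdgeSet {s : Sym2 V | ∃ e, x e = true ∧
          Sum.elim endsP endsQ e = s}).ConnectedComponent +
        Nat.card (fromEdgeSet {s : Sym2 V | ∃ e, x e = false ∧
          Sum.elim endsP endsQ e = s}).ConnectedComponent) = t).card := by
  have hfibL : ∀ ωQ : ιQ → Bool, (univ.filter fun ωP : ιP → Bool => Sum.elim ωP ωQ ∈
      univ.filter fun x : ιP ⊕ ιQ → Bool => x ∈ lSet (Sum.elim endsP endsQ) a b c ∧
        (Nat.card (fromEdgeSet {s : Sym2 V | ∃ e, x e = true ∧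
          Sum.elim endsP endsQ e = s}).ConnectedComponent +
        Nat.card (fromEdgeSet {s : Sym2 V | ∃ e, x e = false ∧
          Sum.elim endsP endsQ e = s}).ConnectedComponent) = t).card =
      (univ.filter fun ωP : ιP → Bool => Sum.elim ωP ωQ ∈ lSet (Sum.elim endsP endsQ) a b c ∧
        (Nat.card (fromEdgeSet {s : Sym2 V | ∃ e, Sum.elim ωP ωQ e = true ∧
          Sum.elim endsP endsQ e = s}).ConnectedComponent +
        Nat.card (fromEdgeSet {s : Sym2 V | ∃ e, Sum.elim ωP ωQ e = false ∧
          Sum.elim endsP endsQ e = s}).ConnectedComponent) = t).card :=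
    fun ωQ => congrArg Finset.card (filter_congr fun ωP _ => by
      simp only [mem_filter, mem_univ, true_and])
  have hfibR : ∀ ωQ : ιQ → Bool, (univ.filter fun ωP : ιP → Bool => Sum.elim ωP ωQ ∈
      univ.filter fun x : ιP ⊕ ιQ → Bool => x ∈ rSet (Sum.elim endsP endsQ) a b c ∧
        (Nat.card (fromEdgeSet {s : Sym2 V | ∃ e, x e = true ∧
          Sum.elim endsP endsQ e = s}).ConnectedComponent +
        Nat.card (fromEdgeSet {s : Sym2 V | ∃ e, x e = false ∧
          Sum.elim endsP endsQ e = s}).ConnectedComponent) = t).card =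
      (univ.filter fun ωP : ιP → Bool => Sum.elim ωP ωQ ∈ rSet (Sum.elim endsP endsQ) a b c ∧
        (Nat.card (fromEdgeSet {s : Sym2 V | ∃ e, Sum.elim ωP ωQ e = true ∧
          Sum.elim endsP endsQ e = s}).ConnectedComponent +
        Nat.card (fromEdgeSet {s : Sym2 V | ∃ e, Sum.elim ωP ωQ e = false ∧
          Sum.elim endsP endsQ e = s}).ConnectedComponent) = t).card :=
    fun ωQ => congrArg Finset.card (filter_congr fun ωP _ => by
      simp only [mem_filter, mem_univ, true_and])
  rw [card_eq_sum_card_fibre (univ.filter fun x : ιP ⊕ ιQ → Bool =>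
      x ∈ lSet (Sum.elim endsP endsQ) a b c ∧
        (Nat.card (fromEdgeSet {s : Sym2 V | ∃ e, x e = true ∧
          Sum.elim endsP endsQ e = s}).ConnectedComponent +
        Nat.card (fromEdgeSet {s : Sym2 V | ∃ e, x e = false ∧
          Sum.elim endsP endsQ e = s}).ConnectedComponent) = t),
    card_eq_sum_card_fibre (univ.filter fun x : ιP ⊕ ιQ → Bool =>
      x ∈ rSet (Sum.elim endsP endsQ) a b c ∧
        (Nat.card (fromEdgeSet {s : Sym2 V | ∃ e, x e = true ∧
          Sum.elim endsP endsQ e = s}).ConnectedComponent +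
        Nat.card (fromEdgeSet {s : Sym2 V | ∃ e, x e = false ∧
          Sum.elim endsP endsQ e = s}).ConnectedComponent) = t)]
  simp only [hfibL, hfibR]
  rw [← sum_flip_eq (fun ωQ => (univ.filter fun ωP : ιP → Bool =>
      Sum.elim ωP ωQ ∈ rSet (Sum.elim endsP endsQ) a b c ∧
        (Nat.card (fromEdgeSet {s : Sym2 V | ∃ e, Sum.elim ωP ωQ e = true ∧
          Sum.elim endsP endsQ e = s}).ConnectedComponent +
        Nat.card (fromEdgeSet {s : Sym2 V | ∃ e, Sum.elim ωP ωQ e = false ∧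
          Sum.elim endsP endsQ e = s}).ConnectedComponent) = t).card)]
  exact sum_congr rfl fun ωQ _ => congrArg Finset.card
    (filter_lSet_grade_eq_rSet_flip_of_apexCut hsep hb hcQ hca ωQ t)

end ApexCut

end AntipodalR1

end Summit.CriticalPhenomena.PercolationContinuityZ3.Theorems
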